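import Literature.Geometry.Lorentzian.GeodesicLimitUniqueness
import Literature.Geometry.Lorentzian.IsometricImmersionExp
import Literature.Geometry.Lorentzian.RadialCausalCone
import Literature.Geometry.Riemannian.TwoPointExpInverse
import HarnessLib

/-!
# Two isometric immersions agreeing to first order at a boundary point agree on the timecone
# issuing from it (the step "`ψ = φ` in `N ∩ Ū`" of Sbierski 2016, §3.2, proof of Thm. 12)

J. Sbierski, *On the existence of a maximal Cauchy development for the Einstein equations: a
dezornification*, Ann. Henri Poincaré 17 (2016) 301–329 = arXiv:1309.7591v3, §3.2, proof of
Theorem 12 (arXiv numbering). After restarting the local uniqueness theorem from a spacelike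
hypersurface `S ⊆ Ū` through a boundary point of the common development `U` — which yields a
development `N ⊇ S` and an isometric immersion `φ : N → M'` with `φ|_S = ψ|_S` — the printed proof
says: *"We now claim that `ψ = φ` holds in `N ∩ Ū` … By the same argument as in the proof of
Corollary 8 we obtain `(dψ)|_S = (dφ)|_S`. The same continuity argument as in the proof of
Lemma 7, but this time applied to `N ∩ Ū`, now proves the claim."* The continuity argument of
Lemma 7 (= O'Neill 1983, Prop. 3.62, `IsometricImmersionRigidity`) runs on a connected OPEN set
and needs a point of first-order agreement INSIDE it, whereas here the agreement is known at a
point `s ∈ S ∩ ∂U` on the boundary of the open set `U ∩ N` on which both maps are isometric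
immersions. This file supplies the missing local step at such a boundary point, by geodesics:

**Theorem (`LorentzianMetric.exists_nhds_eq_of_jet_eq_boundary`).** Let `(M, g, τ)` be a
time-oriented Lorentzian manifold, `U, N ⊆ M` open, `s ∈ N`, `ψ : (U, g|_U) → (M', g')` and
`φ : (N, g|_N) → (M', g')` isometric immersions into an equidimensional pseudo-Riemannian manifold,
and `ψ̂ : M → M'` a map, `C^∞` on an open `W ∋ s`, with `ψ̂ = ψ` on `W ∩ U`, `ψ̂ s = φ s` and
`dψ̂_s = dφ_s` (Sbierski's smooth extension of `ψ` across a corresponding boundary point,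
Lemma 14, with the one-jet of `φ`). Suppose that on some neighbourhood `𝒱₀` of `s` the region
`U` is "chronologically convex from `s`": `z ∈ U` whenever `z, y ∈ 𝒱₀`, `y ∈ U`, `s ≪ z ≪ y`
(for a common development above its Cauchy hypersurface this is the causal convexity of
`SubdevelopmentTimelikeEntry.lean`). Then there is an open set `O ⊆ N` — the image under `exp_s`
of the small future timelike vectors — such that **`ψ = φ` on `O ∩ U`**, and which **every future
timelike curve issuing from `s` enters immediately**.

Proof. Let `y = exp_s w ∈ O ∩ U`, `w` future timelike and small, and `r(θ) = exp_s(θ w)` the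
radial geodesic, future timelike (`RadialCausalCone`), so `s ≪ r θ ≪ y` and `r θ ∈ U ∩ N` for
`0 < θ ≤ 1`. On the one hand `φ ∘ r` is the geodesic of `M'` with initial data
`P₀ = (φ s, dφ_s w)`, defined on `[0, 1]` (isometric immersions commute with `exp`,
`IsIsometricImmersion.expMap_comp`, `IsometricImmersionExp.lean`). On the other hand
`c = ψ̂ ∘ r` is a geodesic of `M'` on the OPEN interval `(0, 1)` — there `c = ψ ∘ r` and `ψ`
is an isometric immersion (`IsIsometricImmersion.isGeodesicOn_comp`) — whose tangent lift tends to
`(ψ̂ s, dψ̂_s w) = P₀` as `θ → 0⁺` (`ψ̂` is smooth at `s`). By the one-sided uniqueness of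
geodesics from limiting data (`IsGeodesicOn.apply_eq_maximalGeodesic_of_tendsto_tangentLift`,
`GeodesicLimitUniqueness.lean`), `ψ y = ψ̂ (r 1) = γ_{P₀}(1) = φ (r 1) = φ y`. That timelike
curves from `s` enter `O` at once: read in the exponential chart at `s` such a curve is
`β(t) = exp_s⁻¹(c t)` with `β(a) = 0`, `β'(a) = c'(a)` future timelike (`d(exp_s)_0 = id`), so
`β(t) = (t - a)(c'(a) + o(1))` lies in the open future timecone for `t > a` small.

Everything is proved; no definitions, no named facts (D-0026). The time-dual statement (past
timecone, curves arriving at `s`) and the global consequence "`ψ = φ` on `U ∩ N`" for a common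
development are derived in `CommonDevelopmentRestartAgreement.lean`.

## References

* J. Sbierski, Ann. Henri Poincaré 17 (2016) 301–329 = arXiv:1309.7591v3, §3.2, proof of
  Thm. 12 and Lemma 14 (arXiv numbering). [Sbierski2016AHP]
* B. O'Neill, *Semi-Riemannian geometry with applications to relativity*, Academic Press 1983,
  Ch. 3, pp. 90–91 (isometries and geodesics), Prop. 3.62; Ch. 5, Lemma 5.33, Prop. 5.34.
  [ONeillSemiRiemannian1983]
-/

noncomputable section

open Bundle Set Filter Function Metric TopologicalSpace
open scoped Manifold ContDiff Topology

namespace Literature.Geometry.Lorentzian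

open Literature.Geometry.Riemannian

variable {d : ℕ} {M : Type*} [TopologicalSpace M] [ChartedSpace (EuclideanSpace ℝ (Fin d)) M]
  [IsManifold (𝓡 d) ∞ M] [T2Space M]
  {M' : Type*} [TopologicalSpace M'] [ChartedSpace (EuclideanSpace ℝ (Fin d)) M']
  [IsManifold (𝓡 d) ∞ M'] [T2Space M']

namespace LorentzianMetric

variable {g : LorentzianMetric (𝓡 d) ∞ M} [g.HasLeviCivita]
  [CovariantDerivative.ContMDiffCovariantDerivative g.leviCivita 1] (τ : TimeOrientation g)
  {g' : PseudoRiemannianMetric (𝓡 d) ∞ (EuclideanSpace ℝ (Fin d)) (TangentSpace (𝓡 d) : M' → Type _)} [g'.HasLeviCivita]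
  [CovariantDerivative.ContMDiffCovariantDerivative g'.leviCivita 1]

/-- **A future timelike curve issuing from the centre of an exponential chart enters the image of
the future timecone at once.** Let `exp_s ∘ K = id` near `s` for a map `K : M → T_sM`, smooth near
`s`, with `K s = 0` (a local inverse of `exp_s`, e.g. the two-point inverse of
`exists_twoPoint_expInverse` at the base point). If `c` is a future timelike curve on `[a, b]`
with `c a = s`, then `K (c t)` is future timelike for all `t > a` close to `a`: `β = K ∘ c` has
`β a = 0` and `β' a = c' a` (`d(exp_s)_0 = id`, `velocity_expMap_comp_of_eq_zero`), so
`(t - a)⁻¹ β t → c' a`, a point of the open future timecone. O'Neill 1983, Ch. 5, proof of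
Lemma 5.33 ("initially `β` is in a single timecone"). [cite: ONeillSemiRiemannian1983, Ch. 5, Lemma 5.33 (p. 146)] -/
theorem eventually_isTimelike_expInverse_comp {s : M} {K : M → (EuclideanSpace ℝ (Fin d))} {V : Set M} (hV : V ∈ 𝓝 s)
    (hK : ContMDiffOn (𝓡 d) 𝓘(ℝ, (EuclideanSpace ℝ (Fin d))) ∞ K V) (hKs : K s = 0)
    (hKexp : ∀ z ∈ V, expMap g.leviCivita s (show TangentSpace (𝓡 d) s from K z) = z)
    {c : ℝ → M} {a b : ℝ} (hab : a < b) (hc : g.IsFutureTimelikeCurveOn τ c (Icc a b))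
    (hca : c a = s) :
    ∀ᶠ t in 𝓝[>] a, g.IsTimelike (x := s) (K (c t)) ∧ τ.IsFutureDirected (x := s) (K (c t)) := by
  have ha : a ∈ Icc a b := left_mem_Icc.2 hab.le
  have hcd : MDifferentiableAt 𝓘(ℝ, ℝ) (𝓡 d) c a := (hc a ha).1
  have hcc : ContinuousAt c a := hcd.continuousAt
  -- `β = K ∘ c` is differentiable at `a` with `β a = 0`
  set β : ℝ → (EuclideanSpace ℝ (Fin d)) := fun t ↦ K (c t) with hβ
  have hKd : MDifferentiableAt (𝓡 d) 𝓘(ℝ, (EuclideanSpace ℝ (Fin d))) K s :=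
    (hK.contMDiffAt hV).mdifferentiableAt (by simp)
  have hβd : DifferentiableAt ℝ β a := by
    have h := (hca ▸ hKd).comp a hcd
    exact mdifferentiableAt_iff_differentiableAt.1 h
  have hβa : β a = 0 := by
    show K (c a) = 0
    rw [hca]
    exact hKs
  -- `exp_s ∘ β = c` near `a`, hence `β' a = c' a`
  have hnear : ∀ᶠ t in 𝓝 a, c t ∈ V := hcc.preimage_mem_nhds (hca ▸ hV)
  have hev : (fun t ↦ expMap g.leviCivita s (show TangentSpace (𝓡 d) s from β t)) =ᶠ[𝓝 a] c := by
    filter_upwards [hnear] with t ht using hKexp (c t) ht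
  have hβ' : deriv β a = velocity (𝓡 d) c a := by
    rw [← velocity_congr_of_eventuallyEq (I := 𝓡 d) hev]
    exact (velocity_expMap_comp_of_eq_zero (cov := g.leviCivita) s hβd.hasDerivAt hβa).symm
  -- the slope `(t - a)⁻¹ β t` tends to `c' a`, a point of the open future timecone
  have hslope : Tendsto (fun t ↦ (t - a)⁻¹ • β t) (𝓝[>] a) (𝓝 (velocity (𝓡 d) c a)) := by
    have h := hβd.hasDerivAt.tendsto_slope
    rw [hβ'] at h
    have h2 : (fun t ↦ (t - a)⁻¹ • β t) =ᶠ[𝓝[≠] a] slope β a := by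
      filter_upwards [self_mem_nhdsWithin] with t ht
      rw [slope_def_module, hβa, sub_zero]
    exact (h.congr' h2.symm).mono_left (nhdsWithin_mono _ fun t ht ↦ ne_of_gt ht)
  have hcone : IsOpen {v : TangentSpace (𝓡 d) s | g.IsTimelike v ∧ τ.IsFutureDirected v} :=
    τ.isOpen_setOf_isTimelike_and_isFutureDirected s
  have hmem : velocity (𝓡 d) c a ∈
      {v : TangentSpace (𝓡 d) s | g.IsTimelike v ∧ τ.IsFutureDirected v} := by
    have h1 := (hc a ha).2.1
    have h2 := (hc a ha).2.2
    rw [hca] at h1 h2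
    exact ⟨h1, h2⟩
  have hev2 : ∀ᶠ t in 𝓝[>] a, (t - a)⁻¹ • β t ∈
      {v : TangentSpace (𝓡 d) s | g.IsTimelike v ∧ τ.IsFutureDirected v} :=
    hslope (hcone.mem_nhds hmem)
  filter_upwards [hev2, self_mem_nhdsWithin] with t ht hta
  have hpos : 0 < t - a := sub_pos.2 hta
  -- the future timecone is a cone
  have hCcone : ∀ (v : TangentSpace (𝓡 d) s) (ρ : ℝ), 0 < ρ →
      g.IsTimelike (ρ • v) ∧ τ.IsFutureDirected (ρ • v) →
        g.IsTimelike v ∧ τ.IsFutureDirected v := fun v ρ hρ hv ↦ by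
    have h1 := hv.1.smul (inv_ne_zero hρ.ne')
    have h2 := hv.2.smul (inv_pos.2 hρ)
    rw [smul_smul, inv_mul_cancel₀ hρ.ne', one_smul] at h1 h2
    exact ⟨h1, h2⟩
  exact hCcone _ _ (inv_pos.2 hpos) ht

/-- **Isometric immersions agreeing to first order at a boundary point agree on the future
timecone issuing from it** (the local step of "`ψ = φ` in `N ∩ Ū`", Sbierski 2016, §3.2, proof
of Thm. 12; see the module docstring for the statement and the proof). The instance hypotheses
on the restricted metrics `g|_U`, `g|_N` (existence and smoothness of their Levi-Civita
connections) are those of `IsometricImmersionExp.lean`.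
[cite: Sbierski2016AHP, §3.2, proof of Thm. 12 (arXiv numbering)] -/
theorem exists_nhds_eq_of_jet_eq_boundary (U N : Opens M)
    [(g.toPseudoRiemannianMetric.restrict PseudoRiemannianMetric.contMDiff_restrict_holds U).HasLeviCivita]
    [CovariantDerivative.ContMDiffCovariantDerivative
      (g.toPseudoRiemannianMetric.restrict PseudoRiemannianMetric.contMDiff_restrict_holds U).leviCivita 1]
    [(g.toPseudoRiemannianMetric.restrict PseudoRiemannianMetric.contMDiff_restrict_holds N).HasLeviCivita]
    [CovariantDerivative.ContMDiffCovariantDerivative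
      (g.toPseudoRiemannianMetric.restrict PseudoRiemannianMetric.contMDiff_restrict_holds N).leviCivita 1]
    {s : M} (hsN : s ∈ N) {ψ : U → M'} {φ : N → M'}
    (hψ : (g.toPseudoRiemannianMetric.restrict PseudoRiemannianMetric.contMDiff_restrict_holds
      U).IsIsometricImmersion g' ψ)
    (hφ : (g.toPseudoRiemannianMetric.restrict PseudoRiemannianMetric.contMDiff_restrict_holds
      N).IsIsometricImmersion g' φ)
    {ψ' : M → M'} {W : Set M} (hW : IsOpen W) (hsW : s ∈ W)
    (hψ's : ContMDiffOn (𝓡 d) (𝓡 d) ∞ ψ' W)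
    (hψ'ψ : ∀ (p : M) (hp : p ∈ U), p ∈ W → ψ' p = ψ ⟨p, hp⟩)
    (h0 : ψ' s = φ ⟨s, hsN⟩)
    (h1 : mfderiv (𝓡 d) (𝓡 d) ψ' s = mfderiv (𝓡 d) (𝓡 d) φ ⟨s, hsN⟩)
    {𝒱₀ : Set M} (h𝒱₀ : 𝒱₀ ∈ 𝓝 s)
    (hconv : ∀ z ∈ 𝒱₀, ∀ y ∈ 𝒱₀, y ∈ U → z ∈ g.chronologicalFuture τ {s} →
      y ∈ g.chronologicalFuture τ {z} → z ∈ U) :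
    ∃ O : Set M, IsOpen O ∧ O ⊆ N ∧
      (∀ (y : M) (hyU : y ∈ U) (hyN : y ∈ N), y ∈ O → ψ ⟨y, hyU⟩ = φ ⟨y, hyN⟩) ∧
      ∀ (c : ℝ → M) (a b : ℝ), a < b → g.IsFutureTimelikeCurveOn τ c (Icc a b) → c a = s →
        ∀ᶠ t in 𝓝[>] a, c t ∈ O := by
  classical
  haveI : Fact ((1 : ℕ∞ω) ≤ ∞) := ⟨by exact_mod_cast (le_top : (1 : ℕ∞) ≤ ⊤)⟩
  haveI := contMDiffCovariantDerivative_leviCivita_infty g.toPseudoRiemannianMetric le_rfl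
  set cov := g.leviCivita with hcov
  set gU := g.toPseudoRiemannianMetric.restrict PseudoRiemannianMetric.contMDiff_restrict_holds U
    with hgU
  set gN := g.toPseudoRiemannianMetric.restrict PseudoRiemannianMetric.contMDiff_restrict_holds N
    with hgN
  -- the uniformly normal neighbourhood and the two-point inverse at `s`
  obtain ⟨W₁, Src, Ξ, hW₁o, hsW₁, hW₁src, hSo, hS0, hSdom, hinjF, hΞ, hΞs, -⟩ :=
    exists_twoPoint_expInverse (cov := cov) s
  set e := trivializationAt (EuclideanSpace ℝ (Fin d)) (TangentSpace (𝓡 d) : M → Type _) s with he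
  set L : (EuclideanSpace ℝ (Fin d)) →L[ℝ] (EuclideanSpace ℝ (Fin d)) := e.symmL ℝ s with hL
  -- the local inverse `K = L ∘ Ξ(s, ·)` of `exp_s` on `W₁`
  set K : M → (EuclideanSpace ℝ (Fin d)) := fun z ↦ L (Ξ s z) with hK
  have hKs' : ContMDiffOn (𝓡 d) 𝓘(ℝ, (EuclideanSpace ℝ (Fin d))) ∞ (fun z ↦ Ξ s z) W₁ := by
    have h1 : ContMDiff (𝓡 d) ((𝓡 d).prod (𝓡 d)) ∞ (fun z : M ↦ (s, z)) :=
      contMDiff_const.prodMk contMDiff_id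
    exact hΞs.comp h1.contMDiffOn fun z hz ↦ ⟨hsW₁, hz⟩
  have hKsm : ContMDiffOn (𝓡 d) 𝓘(ℝ, (EuclideanSpace ℝ (Fin d))) ∞ K W₁ := by
    have hLs : ContMDiff 𝓘(ℝ, (EuclideanSpace ℝ (Fin d))) 𝓘(ℝ, (EuclideanSpace ℝ (Fin d))) ∞ (fun ξ : (EuclideanSpace ℝ (Fin d)) ↦ L ξ) := L.contMDiff
    exact hLs.comp_contMDiffOn hKs'
  have hKexp : ∀ z ∈ W₁, expMap cov s (show TangentSpace (𝓡 d) s from K z) = z := fun z hz ↦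
    (hΞ s hsW₁ z hz).2
  have hKdom : ∀ z ∈ W₁, (show TangentSpace (𝓡 d) s from K z) ∈ expDomain cov s := fun z hz ↦
    (hSdom _ (hΞ s hsW₁ z hz).1).2
  have hΞss : Ξ s s = 0 := by
    have h1' : (s, Ξ s s) ∈ Src := (hΞ s hsW₁ s hsW₁).1
    have h2' : (s, (0 : (EuclideanSpace ℝ (Fin d)))) ∈ Src := hS0 s hsW₁
    have heq : (fun w : M × (EuclideanSpace ℝ (Fin d)) ↦ (w.1, expMap cov w.1 (e.symmL ℝ w.1 w.2))) (s, Ξ s s) =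
        (fun w : M × (EuclideanSpace ℝ (Fin d)) ↦ (w.1, expMap cov w.1 (e.symmL ℝ w.1 w.2))) (s, (0 : (EuclideanSpace ℝ (Fin d)))) := by
      show (s, expMap cov s (e.symmL ℝ s (Ξ s s))) = (s, expMap cov s (e.symmL ℝ s 0))
      rw [(hΞ s hsW₁ s hsW₁).2, map_zero, expMap_zero (cov := cov) s]
    exact (Prod.ext_iff.1 (hinjF h1' h2' heq)).2
  have hK0 : K s = 0 := by simp only [hK, hΞss, map_zero]
  -- the good vectors: `exp_s` lands in `N ∩ W ∩ 𝒱₀ ∩ W₁`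
  set T : Set M := (N : Set M) ∩ W ∩ interior 𝒱₀ ∩ W₁ with hT
  have hTo : IsOpen T := ((N.2.inter hW).inter isOpen_interior).inter hW₁o
  have hsT : s ∈ T := ⟨⟨⟨hsN, hsW⟩, mem_interior_iff_mem_nhds.2 h𝒱₀⟩, hsW₁⟩
  set G : Set (EuclideanSpace ℝ (Fin d)) := {u : (EuclideanSpace ℝ (Fin d)) | (show TangentSpace (𝓡 d) s from u) ∈ expDomain cov s} ∩
    (fun u : (EuclideanSpace ℝ (Fin d)) ↦ expMap cov s (show TangentSpace (𝓡 d) s from u)) ⁻¹' T with hG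
  have hGo : IsOpen G :=
    (contMDiffOn_expMap (cov := cov) (k := 1) le_rfl s).continuousOn.isOpen_inter_preimage
      (isOpen_expDomain (cov := cov) (k := 1) le_rfl s) hTo
  have h0G : (0 : (EuclideanSpace ℝ (Fin d))) ∈ G := by
    refine ⟨zero_mem_expDomain (cov := cov) s, ?_⟩
    show expMap cov s (0 : TangentSpace (𝓡 d) s) ∈ T
    rw [expMap_zero (cov := cov) s]
    exact hsT
  obtain ⟨δ, hδ, hball⟩ := Metric.isOpen_iff.1 hGo 0 h0G
  -- the open future timecone at `s`
  set C : Set (EuclideanSpace ℝ (Fin d)) := {v : (EuclideanSpace ℝ (Fin d)) | g.IsTimelike (x := s) v ∧ τ.IsFutureDirected (x := s) v} with hC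
  have hCo : IsOpen C := τ.isOpen_setOf_isTimelike_and_isFutureDirected s
  -- the neighbourhood `O`
  set O : Set M := W₁ ∩ K ⁻¹' (ball (0 : (EuclideanSpace ℝ (Fin d))) δ ∩ C) with hO
  have hOo : IsOpen O := hKsm.continuousOn.isOpen_inter_preimage hW₁o (isOpen_ball.inter hCo)
  -- radial geodesics from `s` with velocity in `ball 0 δ`
  have hrad : ∀ w ∈ ball (0 : (EuclideanSpace ℝ (Fin d))) δ, ∀ θ ∈ Icc (0 : ℝ) 1,
      (show TangentSpace (𝓡 d) s from θ • w) ∈ expDomain cov s ∧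
        expMap cov s (show TangentSpace (𝓡 d) s from θ • w) ∈ T := by
    intro w hw θ hθ
    have hθw : θ • w ∈ ball (0 : (EuclideanSpace ℝ (Fin d))) δ := by
      rw [mem_ball_zero_iff] at hw ⊢
      calc ‖θ • w‖ = |θ| * ‖w‖ := norm_smul θ w
        _ ≤ 1 * ‖w‖ := by
            refine mul_le_mul_of_nonneg_right ?_ (norm_nonneg _)
            rw [abs_of_nonneg hθ.1]; exact hθ.2
        _ < δ := by rw [one_mul]; exact hw
    exact hball hθw
  have hON : O ⊆ N := by
    intro y hy
    have hw : K y ∈ ball (0 : (EuclideanSpace ℝ (Fin d))) δ := hy.2.1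
    have h := (hrad (K y) hw 1 ⟨zero_le_one, le_rfl⟩).2
    rw [one_smul, hKexp y hy.1] at h
    exact h.1.1.1
  refine ⟨O, hOo, hON, fun y hyU hyN hyO ↦ ?_, fun c a b hab hc hca ↦ ?_⟩
  · /- agreement at `y = exp_s w ∈ O ∩ U` -/
    set w : (EuclideanSpace ℝ (Fin d)) := K y with hw_def
    have hw : w ∈ ball (0 : (EuclideanSpace ℝ (Fin d))) δ := hyO.2.1
    have hwC : g.IsTimelike (x := s) w ∧ τ.IsFutureDirected (x := s) w := hyO.2.2
    have hyW₁ : y ∈ W₁ := hyO.1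
    have hexpw : expMap cov s (show TangentSpace (𝓡 d) s from w) = y := hKexp y hyW₁
    have hwdom : (show TangentSpace (𝓡 d) s from w) ∈ expDomain cov s := hKdom y hyW₁
    -- the radial geodesic `r`
    set r : ℝ → M := fun θ ↦ expMap cov s (show TangentSpace (𝓡 d) s from θ • w) with hr
    have hr1 : r 1 = y := by simp only [hr, one_smul, hexpw]
    have hr0 : r 0 = s := by simp only [hr, zero_smul]; exact expMap_zero (cov := cov) s
    have hrT : ∀ θ ∈ Icc (0 : ℝ) 1, r θ ∈ T := fun θ hθ ↦ (hrad w hw θ hθ).2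
    obtain ⟨hmax, h0D, -, -⟩ := maximalGeodesic_spec' (cov := cov) s
      (show TangentSpace (𝓡 d) s from w)
    have h1D : (1 : ℝ) ∈ maximalGeodesicDomain cov s (show TangentSpace (𝓡 d) s from w) :=
      hwdom.2
    have hIccD : Icc (0 : ℝ) 1 ⊆ maximalGeodesicDomain cov s (show TangentSpace (𝓡 d) s from w) :=
      hmax.2.1.out h0D h1D
    have hrgeo : IsGeodesicOn cov r (maximalGeodesicDomain cov s (show TangentSpace (𝓡 d) s from w)) :=
      isGeodesicOn_expMap_smul (cov := cov) s (show TangentSpace (𝓡 d) s from w)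
    have hrvel : ∀ θ ∈ maximalGeodesicDomain cov s (show TangentSpace (𝓡 d) s from w),
        g.IsTimelike (velocity (𝓡 d) r θ) ∧ τ.IsFutureDirected (velocity (𝓡 d) r θ) :=
      fun θ hθ ↦ isTimelike_isFutureDirected_velocity_expMap_smul τ hwC.1 hwC.2 hθ
    have hrcurve : ∀ θ₁ θ₂, 0 ≤ θ₁ → θ₂ ≤ 1 →
        g.IsFutureTimelikeCurveOn τ r (Icc θ₁ θ₂) := fun θ₁ θ₂ h1 h2 θ hθ ↦ by
      have hθD : θ ∈ maximalGeodesicDomain cov s (show TangentSpace (𝓡 d) s from w) :=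
        hIccD ⟨h1.trans hθ.1, hθ.2.trans h2⟩
      exact ⟨IsGeodesicOn.mdifferentiableAt_holds hrgeo hθD, hrvel θ hθD⟩
    -- `s ≪ r θ ≪ y` for `0 < θ < 1`, hence `r θ ∈ U`
    have hrU : ∀ θ ∈ Ioc (0 : ℝ) 1, r θ ∈ U := by
      intro θ hθ
      rcases hθ.2.eq_or_lt with rfl | hθ1
      · rw [hr1]; exact hyU
      have hz : r θ ∈ g.chronologicalFuture τ {s} :=
        ⟨s, rfl, r, 0, θ, hθ.1, hrcurve 0 θ le_rfl hθ1.le, hr0, rfl⟩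
      have hzy : y ∈ g.chronologicalFuture τ {r θ} :=
        ⟨r θ, rfl, r, θ, 1, hθ1, hrcurve θ 1 hθ.1.le le_rfl, rfl, hr1⟩
      have hz𝒱 : r θ ∈ 𝒱₀ := interior_subset (hrT θ ⟨hθ.1.le, hθ.2⟩).1.2
      have hy𝒱 : y ∈ 𝒱₀ := by
        have h := (hrT 1 ⟨zero_le_one, le_rfl⟩).1.2
        rw [hr1] at h
        exact interior_subset h
      exact hconv (r θ) hz𝒱 y hy𝒱 hyU hz hzy
    /- (1) `φ ∘ r` is the maximal geodesic `γ_{P₀}`, `P₀ = (φ s, dφ_s w)`, on `[0, 1]` -/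
    have hwN : (show TangentSpace (𝓡 d) (⟨s, hsN⟩ : N) from w) ∈ expDomain gN.leviCivita ⟨s, hsN⟩ ∧
        ((expMap gN.leviCivita ⟨s, hsN⟩ (show TangentSpace (𝓡 d) (⟨s, hsN⟩ : N) from w) : N) : M) =
          expMap cov s (show TangentSpace (𝓡 d) s from w) :=
      PseudoRiemannianMetric.mem_expDomain_restrict_of_forall g.toPseudoRiemannianMetric N
        (y := ⟨s, hsN⟩) hwdom fun θ hθ ↦ (hrT θ hθ).1.1.1
    obtain ⟨hP₀dom, hP₀exp⟩ := hφ.expMap_comp rfl hwN.1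
    set v' : (EuclideanSpace ℝ (Fin d)) := mfderiv (𝓡 d) (𝓡 d) φ ⟨s, hsN⟩ w with hv'
    have hφy : expMap g'.leviCivita (φ ⟨s, hsN⟩)
        (show TangentSpace (𝓡 d) (φ ⟨s, hsN⟩) from v') = φ ⟨y, hyN⟩ := by
      rw [hP₀exp]
      congr 1
      exact Subtype.ext (hwN.2.trans hexpw)
    obtain ⟨hmax', h0D', -, -⟩ := maximalGeodesic_spec' (cov := g'.leviCivita) (φ ⟨s, hsN⟩)
      (show TangentSpace (𝓡 d) (φ ⟨s, hsN⟩) from v')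
    have h1D' : (1 : ℝ) ∈ maximalGeodesicDomain g'.leviCivita (φ ⟨s, hsN⟩)
        (show TangentSpace (𝓡 d) (φ ⟨s, hsN⟩) from v') := hP₀dom.2
    have hIccD' : Icc (0 : ℝ) 1 ⊆ maximalGeodesicDomain g'.leviCivita (φ ⟨s, hsN⟩)
        (show TangentSpace (𝓡 d) (φ ⟨s, hsN⟩) from v') := hmax'.2.1.out h0D' h1D'
    have hγ1 : maximalGeodesic g'.leviCivita (φ ⟨s, hsN⟩)
        (show TangentSpace (𝓡 d) (φ ⟨s, hsN⟩) from v') 1 = φ ⟨y, hyN⟩ := by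
      rw [← hφy, ← (expMap_smul_of_mem (cov := g'.leviCivita) (φ ⟨s, hsN⟩)
        (show TangentSpace (𝓡 d) (φ ⟨s, hsN⟩) from v') h1D').2, one_smul]
    /- (2) `c = ψ' ∘ r` is a geodesic of `g'` on `(0, 1)` -/
    set cc : ℝ → M' := fun θ ↦ ψ' (r θ) with hcc
    -- the radial geodesic as a curve of `U` on `(0, 1]`
    set ρ : ℝ → U := fun θ ↦ if h : r θ ∈ U then ⟨r θ, h⟩ else ⟨y, hyU⟩ with hρ
    have hρval : ∀ θ ∈ Ioc (0 : ℝ) 1, ((ρ θ : U) : M) = r θ := fun θ hθ ↦ by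
      simp only [hρ, dif_pos (hrU θ hθ)]
    have hρgeo : IsGeodesicOn gU.leviCivita ρ (Ioo 0 1) := by
      rw [PseudoRiemannianMetric.isGeodesicOn_restrict_iff g.toPseudoRiemannianMetric U isOpen_Ioo]
      refine IsGeodesicOn.congr_holds (hrgeo.mono fun θ hθ ↦ hIccD ⟨hθ.1.le, hθ.2.le⟩) isOpen_Ioo
        fun θ hθ ↦ ?_
      exact (hρval θ ⟨hθ.1, hθ.2.le⟩).symm
    obtain ⟨hψρ, -⟩ := hψ.isGeodesicOn_comp rfl isOpen_Ioo hρgeo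
    have hccgeo : IsGeodesicOn g'.leviCivita cc (Ioo 0 1) := by
      refine IsGeodesicOn.congr_holds hψρ isOpen_Ioo fun θ hθ ↦ ?_
      show ψ (ρ θ) = ψ' (r θ)
      have hθ' : θ ∈ Ioc (0 : ℝ) 1 := ⟨hθ.1, hθ.2.le⟩
      rw [hψ'ψ (r θ) (hrU θ hθ') (hrT θ ⟨hθ.1.le, hθ.2.le⟩).1.1.2]
      congr 1
      exact Subtype.ext (hρval θ hθ')
    /- (3) the tangent lift of `c` tends to `P₀ = (φ s, dφ_s w)` as `θ → 0⁺` -/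
    have hrd : ∀ θ ∈ maximalGeodesicDomain cov s (show TangentSpace (𝓡 d) s from w),
        MDifferentiableAt 𝓘(ℝ, ℝ) (𝓡 d) r θ := fun θ hθ ↦
      IsGeodesicOn.mdifferentiableAt_holds hrgeo hθ
    have hψ'd : ∀ p ∈ W, MDifferentiableAt (𝓡 d) (𝓡 d) ψ' p := fun p hp ↦
      (hψ's.contMDiffAt (hW.mem_nhds hp)).mdifferentiableAt (by simp)
    have hDo : IsOpen (maximalGeodesicDomain cov s (show TangentSpace (𝓡 d) s from w)) :=
      hmax.isOpen
    have hrW : ∀ᶠ θ in 𝓝 (0 : ℝ), r θ ∈ W := by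
      have hc0 : ContinuousAt r 0 := (hrd 0 h0D).continuousAt
      exact hc0.preimage_mem_nhds (hW.mem_nhds (by rw [hr0]; exact hsW))
    have hlift : ∀ᶠ θ in 𝓝 (0 : ℝ), tangentLift (𝓡 d) cc θ =
        tangentMap (𝓡 d) (𝓡 d) ψ' (tangentLift (𝓡 d) r θ) := by
      filter_upwards [hrW, hDo.mem_nhds h0D] with θ hθW hθD
      have hv : velocity (𝓡 d) cc θ = mfderiv (𝓡 d) (𝓡 d) ψ' (r θ) (velocity (𝓡 d) r θ) := by
        simp only [velocity]
        rw [show cc = ψ' ∘ r from rfl, mfderiv_comp θ (hψ'd _ hθW) (hrd θ hθD)]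
        rfl
      exact TotalSpace.ext rfl (heq_of_eq hv)
    have hTcont : ContinuousAt (tangentMap (𝓡 d) (𝓡 d) ψ') (tangentLift (𝓡 d) r 0) := by
      have h2 : ContinuousOn (tangentMapWithin (𝓡 d) (𝓡 d) ψ' W)
          (TotalSpace.proj ⁻¹' W : Set (TangentBundle (𝓡 d) M)) :=
        hψ's.continuousOn_tangentMapWithin (WithTop.coe_le_coe.mpr le_top) hW.uniqueMDiffOn
      have hopen : IsOpen (TotalSpace.proj ⁻¹' W : Set (TangentBundle (𝓡 d) M)) :=
        hW.preimage (FiberBundle.continuous_proj (EuclideanSpace ℝ (Fin d)) (TangentSpace (𝓡 d)))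
      have hmem : tangentLift (𝓡 d) r 0 ∈ (TotalSpace.proj ⁻¹' W : Set (TangentBundle (𝓡 d) M)) := by
        show r 0 ∈ W
        rw [hr0]
        exact hsW
      have h3 : ContinuousAt (tangentMapWithin (𝓡 d) (𝓡 d) ψ' W) (tangentLift (𝓡 d) r 0) :=
        h2.continuousAt (hopen.mem_nhds hmem)
      refine h3.congr ?_
      filter_upwards [hopen.mem_nhds hmem] with p hp
      exact tangentMapWithin_eq_tangentMap (hW.uniqueMDiffOn p.proj hp) (hψ'd p.proj hp)
    have hrlift : ContinuousAt (tangentLift (𝓡 d) r) 0 := (hrgeo.1 0 h0D).continuousAt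
    have hlim0 : Tendsto (tangentLift (𝓡 d) cc) (𝓝 0)
        (𝓝 (tangentMap (𝓡 d) (𝓡 d) ψ' (tangentLift (𝓡 d) r 0))) := by
      have h := hTcont.tendsto.comp hrlift.tendsto
      exact h.congr' (hlift.mono fun θ hθ ↦ hθ.symm)
    set P₀ : TangentBundle (𝓡 d) M' :=
      TotalSpace.mk' (EuclideanSpace ℝ (Fin d)) (φ ⟨s, hsN⟩) (show TangentSpace (𝓡 d) (φ ⟨s, hsN⟩) from v') with hP₀
    have hlimP : tangentMap (𝓡 d) (𝓡 d) ψ' (tangentLift (𝓡 d) r 0) = P₀ := by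
      have hv0 : velocity (𝓡 d) r 0 = (show TangentSpace (𝓡 d) s from w) :=
        velocity_expMap_smul_zero (cov := cov) s (show TangentSpace (𝓡 d) s from w)
      have htl0 : tangentLift (𝓡 d) r 0 = TotalSpace.mk' (EuclideanSpace ℝ (Fin d)) s (show TangentSpace (𝓡 d) s from w) :=
        TotalSpace.ext hr0 (heq_of_eq hv0)
      rw [htl0]
      show TotalSpace.mk' (EuclideanSpace ℝ (Fin d)) (ψ' s) (mfderiv (𝓡 d) (𝓡 d) ψ' s w) = P₀
      have h1w : mfderiv (𝓡 d) (𝓡 d) ψ' s w = v' := DFunLike.congr_fun h1 w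
      exact TotalSpace.ext h0 (heq_of_eq h1w)
    have hlim : Tendsto (tangentLift (𝓡 d) cc) (𝓝[>] 0) (𝓝 P₀) := by
      rw [← hlimP]
      exact hlim0.mono_left nhdsWithin_le_nhds
    /- (4) conclude by the one-sided uniqueness of geodesics from limiting data -/
    have hy1W : y ∈ W := by
      have h := (hrT 1 ⟨zero_le_one, le_rfl⟩).1.1.2
      rwa [hr1] at h
    have hcc1 : Tendsto cc (𝓝[<] 1) (𝓝 (cc 1)) := by
      have h1W : r 1 ∈ W := (hrT 1 ⟨zero_le_one, le_rfl⟩).1.1.2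
      have hca : ContinuousAt cc 1 :=
        (hψ'd _ h1W).continuousAt.comp (hrd 1 h1D).continuousAt
      exact hca.tendsto.mono_left nhdsWithin_le_nhds
    have key := hccgeo.apply_eq_maximalGeodesic_of_tendsto_tangentLift zero_lt_one hlim
      (fun θ hθ ↦ hIccD' ⟨hθ.1.le, hθ.2.le⟩) h1D' hcc1
    calc ψ ⟨y, hyU⟩ = ψ' y := (hψ'ψ y hyU hy1W).symm
      _ = cc 1 := by simp only [hcc, hr1]
      _ = maximalGeodesic g'.leviCivita (φ ⟨s, hsN⟩)
            (show TangentSpace (𝓡 d) (φ ⟨s, hsN⟩) from v') 1 := key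
      _ = φ ⟨y, hyN⟩ := hγ1
  · /- a future timelike curve from `s` enters `O` at once -/
    have hev := eventually_isTimelike_expInverse_comp τ (hW₁o.mem_nhds hsW₁) hKsm hK0 hKexp
      hab hc hca
    have ha : a ∈ Icc a b := left_mem_Icc.2 hab.le
    have hcc' : ContinuousAt c a := (hc a ha).1.continuousAt
    have hW₁ev : ∀ᶠ t in 𝓝 a, c t ∈ W₁ :=
      hcc'.preimage_mem_nhds (by rw [hca]; exact hW₁o.mem_nhds hsW₁)
    have hKc : ContinuousAt (fun t ↦ K (c t)) a := by
      have hKca : ContinuousAt K (c a) := by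
        rw [hca]
        exact (hKsm.contMDiffAt (hW₁o.mem_nhds hsW₁)).continuousAt
      exact hKca.comp hcc'
    have hballev : ∀ᶠ t in 𝓝 a, K (c t) ∈ ball (0 : (EuclideanSpace ℝ (Fin d))) δ :=
      hKc.preimage_mem_nhds (isOpen_ball.mem_nhds (by
        show K (c a) ∈ ball (0 : (EuclideanSpace ℝ (Fin d))) δ
        rw [hca, hK0]
        exact mem_ball_self hδ))
    filter_upwards [hev, nhdsWithin_le_nhds hW₁ev, nhdsWithin_le_nhds hballev] with t ht htW hball'
    exact ⟨htW, hball', ht⟩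

end LorentzianMetric

end Literature.Geometry.Lorentzian

end
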